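import Summits.MatrixMultiplication.OmegaCensus.SmallFormats.InvertiblePointLineColumns
import HarnessLib

/-!
# ω-census family (a): the two kernel inputs of the δ-ENGINE (block footprint + Brent on the common kernel) at a saturated point

Cell `pub-omega` (unit `pub-omega-tensor-g24`), topic `Summits/MatrixMultiplication/OmegaCensus` (sub-folder `SmallFormats`).
Framing (verbatim): lottery ticket; floor = certified bounds/negative ranges. HONEST FRAMING: two short identities, continuing
`InvertiblePointFrame` (p434823) and `InvertiblePointLineColumns` (p471507); they are exactly the facts from which the search-free
'δ-engine' of tensor g24 (`DELTA-ENGINE.md`: all 1 092 IP-orbits of the `𝔽₃` `⟨2,2,6⟩ @ 20` census excluded by exact linear algebra)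
starts — everything after them is rank arithmetic on explicit `𝔽₃` matrices. Not a rank bound, nothing on `ω`.

A 'block' is read through right multiplication by a fixed matrix `M` (`W ↦ W M`, e.g. a column selection), which commutes with the
left action `W ↦ X W`. Setting: `β` computes `X ↦ XY` on `k^{2×2} × k^{2×n}`, the cap is attained at `X₀ = 1` (`|O| = 2n`, `O` = the
terms with `f_i(1) ≠ 0`), and `S` is a subspace of `k^{2×m}` containing the blocks `W_t M` of all outputs of the terms vanishing at `1`.
* `block_footprint_mem` — for `s ∈ O` and every `X`: `X (W_s M) − (f_s(X)/f_s(1)) (W_s M) ∈ S` (the block of the output footprint);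
* `mul_block_eq_sum_of_forall_g_eq_zero` — for `W` killed by every `g_t`, `t ∉ O`: `X (W M) = Σ_{s∈O} f_s(X) g_s(W) (W_s M)`;
* `flip_mul_block_mem_span` — hence the map `X ↦ X (W M)` lies in the span of the maps `X ↦ f_s(X)·B`, `B` in the block-footprint
  space of `s ∈ O` (the δ-engine's membership statement);
* `finrank_block_map_ker_le` — hence `dim {W M : W ∈ ⋂_{t∉O} ker g_t} ≤ δ := dim (range(B ↦ (X ↦ X·B)) ⊓ that span)`
  (the per-block bound the δ-engine sums over the blocks of a Kronecker type);
* `two_mul_le_sum_delta_add` — the δ-engine theorem: for jointly injective blocks `(M_b, S_b)`, `2n ≤ Σ_b δ_b + |Z|`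
  (`finrank_le_sum_finrank_map` + rank–nullity), everything but the numbers `δ_b` kernel-checked.
Hence (desk, `DELTA-ENGINE.md` §1): the linear map `X ↦ X·(WM)` lies in the span of the maps `X ↦ (f_s(X)/f_s(1))·B` with `B` in the
block-footprint space of the class of `s`, which bounds `dim {WM : W ∈ ⋂ ker g_t}` by an explicit rank `δ`.
-/

namespace Summit.MatrixMultiplication.OmegaCensus.SmallFormats

open Module Matrix Literature.Computability.AlgebraicComplexity

variable {k : Type*} [Field k] {n m : ℕ} {ι : Type*} [Fintype ι] [DecidableEq ι]

/-- **Block footprint.** At a saturated `X₀ = 1`, if the blocks `W_t M` (`t ∉ O`) lie in a subspace `S`, then for `s ∈ O` and every `X`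
the block of the output footprint, `X (W_s M) − (f_s(X) f_s(1)⁻¹) (W_s M)`, lies in `S`. -/
theorem block_footprint_mem (β : BilinComp (mulBilin k 2 2 n) ι) (O : Finset ι)
    (hO : ∀ i, i ∉ O → β.f i 1 = 0) (hO' : ∀ i ∈ O, β.f i 1 ≠ 0) (hcard : O.card = 2 * n)
    (M : Matrix (Fin n) (Fin m) k) (S : Submodule k (Matrix (Fin 2) (Fin m) k))
    (hS : ∀ t, t ∉ O → β.w t * M ∈ S) {s : ι} (hs : s ∈ O) (X : Matrix (Fin 2) (Fin 2) k) :
    X * (β.w s * M) - (β.f s X * (β.f s 1)⁻¹) • (β.w s * M) ∈ S := by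
  classical
  have h := footprint_w_eq β 1 isUnit_det_one_fin_two O hO hO' hcard hs X
  rw [inv_one, Matrix.one_mul] at h
  have hM : X * (β.w s * M) - (β.f s X * (β.f s 1)⁻¹) • (β.w s * M) =
      (X * β.w s - (β.f s X * (β.f s 1)⁻¹) • β.w s) * M := by
    rw [Matrix.sub_mul, Matrix.mul_assoc, Matrix.smul_mul]
  rw [hM, h, Matrix.sum_mul]
  refine Submodule.sum_mem _ fun t ht => ?_
  rw [Matrix.smul_mul]
  exact Submodule.smul_mem _ _ (hS t (Finset.mem_sdiff.mp ht).2)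

omit [DecidableEq ι] in
/-- **Brent on the common kernel, block form.** If `W` is killed by every `g_t`, `t ∉ O`, then for every `X`:
`X (W M) = Σ_{s∈O} f_s(X) g_s(W) · (W_s M)`. -/
theorem mul_block_eq_sum_of_forall_g_eq_zero (β : BilinComp (mulBilin k 2 2 n) ι) (O : Finset ι)
    (M : Matrix (Fin n) (Fin m) k) {W : Matrix (Fin 2) (Fin n) k} (hW : ∀ t, t ∉ O → β.g t W = 0)
    (X : Matrix (Fin 2) (Fin 2) k) :
    X * (W * M) = ∑ s ∈ O, (β.f s X * β.g s W) • (β.w s * M) := by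
  have hB := β.map_eq_sum X W
  rw [mulBilin_apply] at hB
  have hXW : X * W = ∑ s ∈ O, (β.f s X * β.g s W) • β.w s := by
    rw [hB, ← Finset.sum_subset (Finset.subset_univ O)]
    intro l _ hl
    rw [hW l hl, mul_zero, zero_smul]
  rw [← Matrix.mul_assoc, hXW, Matrix.sum_mul]
  refine Finset.sum_congr rfl fun s _ => ?_
  rw [Matrix.smul_mul]

/-- **Transport on the common kernel, block form.** For `W` killed by every `g_t` (`t ∉ O`), `s ∈ O` and every `X`:
`f_s(1) · g_s(X W) = f_s(X) · g_s(W)` — restated from `f_one_mul_g_mul` for convenience of the δ-engine's soundness map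
(the coefficient functionals `X ↦ f_s(X) g_s(W)` are the `f_s` up to the scalars `g_s(W)`). -/
theorem coeff_transport (β : BilinComp (mulBilin k 2 2 n) ι) (O : Finset ι) (hO : ∀ i, i ∉ O → β.f i 1 = 0)
    (hcard : O.card = 2 * n) {W : Matrix (Fin 2) (Fin n) k} (hW : ∀ t, t ∉ O → β.g t W = 0) {s : ι} (hs : s ∈ O)
    (X : Matrix (Fin 2) (Fin 2) k) : β.f s 1 * β.g s (X * W) = β.f s X * β.g s W :=
  f_one_mul_g_mul β O hO hcard hW hs X

/-- **The δ-engine's membership statement (DELTA-ENGINE.md §1 (ii)–(iii)).** At a saturated `X₀ = 1`, if the blocks `W_t M`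
(`t ∉ O`) lie in `S` and `W` is killed by every `g_t` (`t ∉ O`), then the linear map `X ↦ X·(W M)` lies in the span of the
maps `X ↦ f_s(X)·B` with `s ∈ O` and `B` in the block-footprint space of `s` (all `B` with `X B − (f_s(X) f_s(1)⁻¹) B ∈ S`
for every `X`). Since `B ↦ (X ↦ X·B)` is injective, this bounds `dim {W M : W ∈ ⋂ ker g_t}` by the dimension `δ` of the
intersection of that span with the right multiplications — the number the engine computes by exact linear algebra. -/
theorem flip_mul_block_mem_span (β : BilinComp (mulBilin k 2 2 n) ι) (O : Finset ι)
    (hO : ∀ i, i ∉ O → β.f i 1 = 0) (hO' : ∀ i ∈ O, β.f i 1 ≠ 0) (hcard : O.card = 2 * n)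
    (M : Matrix (Fin n) (Fin m) k) (S : Submodule k (Matrix (Fin 2) (Fin m) k))
    (hS : ∀ t, t ∉ O → β.w t * M ∈ S) {W : Matrix (Fin 2) (Fin n) k} (hW : ∀ t, t ∉ O → β.g t W = 0) :
    (mulBilin k 2 2 m).flip (W * M) ∈ Submodule.span k
      {L : Matrix (Fin 2) (Fin 2) k →ₗ[k] Matrix (Fin 2) (Fin m) k |
        ∃ s ∈ O, ∃ B : Matrix (Fin 2) (Fin m) k,
          (∀ X : Matrix (Fin 2) (Fin 2) k, X * B - (β.f s X * (β.f s 1)⁻¹) • B ∈ S) ∧ L = (β.f s).smulRight B} := by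
  have key : (mulBilin k 2 2 m).flip (W * M) = ∑ s ∈ O, β.g s W • (β.f s).smulRight (β.w s * M) := by
    apply LinearMap.ext
    intro X
    rw [LinearMap.flip_apply, mulBilin_apply, mul_block_eq_sum_of_forall_g_eq_zero β O M hW X,
      LinearMap.coe_sum, Finset.sum_apply]
    refine Finset.sum_congr rfl fun s _ => ?_
    rw [LinearMap.smul_apply, LinearMap.smulRight_apply, smul_smul, mul_comm]
  rw [key]
  refine Submodule.sum_mem _ fun s hs => Submodule.smul_mem _ _ (Submodule.subset_span ?_)
  exact ⟨s, hs, β.w s * M, fun X => block_footprint_mem β O hO hO' hcard M S hS hs X, rfl⟩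

/-- `B ↦ (X ↦ X·B)` is injective (evaluate at `X = 1`). -/
theorem flip_mulBilin_injective : Function.Injective ((mulBilin k 2 2 m).flip) := by
  intro B B' h
  have := LinearMap.congr_fun h (1 : Matrix (Fin 2) (Fin 2) k)
  rw [LinearMap.flip_apply, LinearMap.flip_apply, mulBilin_apply, mulBilin_apply, Matrix.one_mul, Matrix.one_mul] at this
  exact this

/-- **The δ-bound in kernel form (DELTA-ENGINE.md §1 (iii)).** At a saturated `X₀ = 1` with the blocks `W_t M` (`t ∉ O`) in `S`:
the blocks `W M` of the common kernel `K₀ = ⋂_{t∉O} ker g_t` form a space of dimension at most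
`δ := dim (range(B ↦ (X ↦ X·B)) ⊓ 𝒯_S)`, `𝒯_S` the span of the maps `X ↦ f_s(X)·B` over `s ∈ O` and `B` in the block-footprint
space of `s`. (The engine computes `δ` by exact linear algebra and sums it over the blocks of a Kronecker type.) -/
theorem finrank_block_map_ker_le (β : BilinComp (mulBilin k 2 2 n) ι) (O : Finset ι)
    (hO : ∀ i, i ∉ O → β.f i 1 = 0) (hO' : ∀ i ∈ O, β.f i 1 ≠ 0) (hcard : O.card = 2 * n)
    (M : Matrix (Fin n) (Fin m) k) (S : Submodule k (Matrix (Fin 2) (Fin m) k))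
    (hS : ∀ t, t ∉ O → β.w t * M ∈ S) :
    finrank k ((LinearMap.ker (LinearMap.pi fun t : ↥(Finset.univ \ O) => β.g (t : ι))).map
        ((mulBilin k 2 n m).flip M)) ≤
      finrank k (LinearMap.range ((mulBilin k 2 2 m).flip) ⊓ Submodule.span k
        {L : Matrix (Fin 2) (Fin 2) k →ₗ[k] Matrix (Fin 2) (Fin m) k |
          ∃ s ∈ O, ∃ B : Matrix (Fin 2) (Fin m) k,
            (∀ X : Matrix (Fin 2) (Fin 2) k, X * B - (β.f s X * (β.f s 1)⁻¹) • B ∈ S) ∧ L = (β.f s).smulRight B} :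
        Submodule k (Matrix (Fin 2) (Fin 2) k →ₗ[k] Matrix (Fin 2) (Fin m) k)) := by
  set K₀ := LinearMap.ker (LinearMap.pi fun t : ↥(Finset.univ \ O) => β.g (t : ι)) with hK₀
  set F := (mulBilin k 2 2 m).flip with hF
  have hinj : Function.Injective F := flip_mulBilin_injective
  -- the blocks of `K₀`, pushed through the injective `F`, land in `range F ⊓ 𝒯`
  have hle : (K₀.map ((mulBilin k 2 n m).flip M)).map F ≤ LinearMap.range F ⊓ Submodule.span k
      {L : Matrix (Fin 2) (Fin 2) k →ₗ[k] Matrix (Fin 2) (Fin m) k |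
        ∃ s ∈ O, ∃ B : Matrix (Fin 2) (Fin m) k,
          (∀ X : Matrix (Fin 2) (Fin 2) k, X * B - (β.f s X * (β.f s 1)⁻¹) • B ∈ S) ∧ L = (β.f s).smulRight B} := by
    rintro L ⟨P, hP, rfl⟩
    obtain ⟨W, hW, rfl⟩ := Submodule.mem_map.mp hP
    refine ⟨LinearMap.mem_range_self F _, ?_⟩
    have hW' : ∀ t, t ∉ O → β.g t W = 0 := fun t ht => by
      have h := LinearMap.mem_ker.mp hW
      have := congr_fun h ⟨t, Finset.mem_sdiff.mpr ⟨Finset.mem_univ t, ht⟩⟩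
      simpa using this
    rw [LinearMap.flip_apply, mulBilin_apply, hF]
    exact flip_mul_block_mem_span β O hO hO' hcard M S hS hW'
  calc finrank k (K₀.map ((mulBilin k 2 n m).flip M))
      = finrank k ((K₀.map ((mulBilin k 2 n m).flip M)).map F) :=
        (LinearEquiv.finrank_eq (Submodule.equivMapOfInjective F hinj _))
    _ ≤ _ := Submodule.finrank_mono hle

/-- Linear algebra: if the maps `π b` are jointly injective on `K`, then `dim K ≤ Σ_b dim π_b(K)` (embed `K` into the product
of its images). -/
theorem finrank_le_sum_finrank_map {V : Type*} [AddCommGroup V] [Module k V] [Module.Finite k V]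
    {ι' : Type*} [Fintype ι'] {P : ι' → Type*} [∀ b, AddCommGroup (P b)] [∀ b, Module k (P b)]
    [∀ b, Module.Finite k (P b)] (K : Submodule k V) (π : ∀ b, V →ₗ[k] P b)
    (hinj : ∀ W ∈ K, (∀ b, π b W = 0) → W = 0) :
    finrank k K ≤ ∑ b, finrank k (K.map (π b)) := by
  let Φ : K →ₗ[k] (∀ b, K.map (π b)) :=
    LinearMap.pi fun b => LinearMap.codRestrict (K.map (π b)) ((π b).domRestrict K)
      fun W => Submodule.mem_map_of_mem W.2
  have hΦ : Function.Injective Φ := by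
    intro W W' h
    apply Subtype.ext
    have h0 : (W : V) - W' ∈ K := K.sub_mem W.2 W'.2
    have : (W : V) - W' = 0 := hinj _ h0 fun b => by
      have hb := congr_arg (fun F => ((F b : K.map (π b)) : P b)) h
      simp only [Φ, LinearMap.pi_apply, LinearMap.codRestrict_apply, LinearMap.domRestrict_apply] at hb
      rw [map_sub, hb, sub_self]
    exact sub_eq_zero.mp this
  calc finrank k K ≤ finrank k (∀ b, K.map (π b)) := LinearMap.finrank_le_finrank_of_injective hΦ
    _ = ∑ b, finrank k (K.map (π b)) := Module.finrank_pi_fintype k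

/-- **The δ-ENGINE theorem in kernel form (DELTA-ENGINE.md §1), up to the numbers δ_b.** At a saturated `X₀ = 1` of a computation
of `⟨2,2,n⟩` with `|O| = 2n`, let `(M_b, S_b)_b` be finitely many blocks (right multiplications `W ↦ W M_b`, jointly injective — e.g. a
partition of the columns) with block spaces `S_b ∋ W_t M_b` for all `t ∉ O`. Then
`2n ≤ Σ_b δ_b + (|ι| − |O|)`, `δ_b := dim (range(B ↦ (X ↦ X·B)) ⊓ 𝒯_{S_b})`: i.e. `dim K₀ ≥ 2n − |Z|` and `dim K₀ ≤ Σ_b δ_b`.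
The census instrument evaluates the `δ_b` by exact linear algebra over `𝔽₃` and finds `Σ_b δ_b < 4 = 2n − |Z|` (or `= 4` with a free
column, `InvertiblePointLineColumns`) for every surviving Kronecker type at every recorded check of every IP-orbit of `⟨2,2,6⟩ @ 20`. -/
theorem two_mul_le_sum_delta_add (β : BilinComp (mulBilin k 2 2 n) ι) (O : Finset ι)
    (hO : ∀ i, i ∉ O → β.f i 1 = 0) (hO' : ∀ i ∈ O, β.f i 1 ≠ 0) (hcard : O.card = 2 * n)
    {ι' : Type*} [Fintype ι'] (m : ι' → ℕ) (M : ∀ b, Matrix (Fin n) (Fin (m b)) k)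
    (hM : ∀ W : Matrix (Fin 2) (Fin n) k, (∀ b, W * M b = 0) → W = 0)
    (S : ∀ b, Submodule k (Matrix (Fin 2) (Fin (m b)) k)) (hS : ∀ b, ∀ t, t ∉ O → β.w t * M b ∈ S b) :
    2 * n ≤ (∑ b, finrank k (LinearMap.range ((mulBilin k 2 2 (m b)).flip) ⊓ Submodule.span k
        {L : Matrix (Fin 2) (Fin 2) k →ₗ[k] Matrix (Fin 2) (Fin (m b)) k |
          ∃ s ∈ O, ∃ B : Matrix (Fin 2) (Fin (m b)) k,
            (∀ X : Matrix (Fin 2) (Fin 2) k, X * B - (β.f s X * (β.f s 1)⁻¹) • B ∈ S b) ∧ L = (β.f s).smulRight B} :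
        Submodule k (Matrix (Fin 2) (Fin 2) k →ₗ[k] Matrix (Fin 2) (Fin (m b)) k))) +
      (Fintype.card ι - O.card) := by
  classical
  set Zs : Finset ι := Finset.univ \ O with hZs
  let φ : Matrix (Fin 2) (Fin n) k →ₗ[k] (Zs → k) := LinearMap.pi fun t => β.g (t : ι)
  set K₀ := LinearMap.ker φ with hK₀
  -- `dim K₀ + |Z| ≥ 2n`
  have hdimK : 2 * n ≤ finrank k K₀ + (Fintype.card ι - O.card) := by
    have h1 := LinearMap.finrank_range_add_finrank_ker φ
    rw [finrank_matrix_fin, ← hK₀] at h1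
    have h2 : finrank k (LinearMap.range φ) ≤ Fintype.card ι - O.card := by
      calc finrank k (LinearMap.range φ) ≤ finrank k (Zs → k) := Submodule.finrank_le _
        _ = Fintype.card ι - O.card := by
            rw [finrank_fintype_fun_eq_card, Fintype.card_coe, hZs, Finset.card_sdiff, Finset.inter_univ,
              Finset.card_univ]
    omega
  -- `dim K₀ ≤ Σ_b dim (K₀ M_b) ≤ Σ_b δ_b`
  have hsum : finrank k K₀ ≤ ∑ b, finrank k (K₀.map ((mulBilin k 2 n (m b)).flip (M b))) :=
    finrank_le_sum_finrank_map K₀ (fun b => (mulBilin k 2 n (m b)).flip (M b)) fun W _ hW =>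
      hM W fun b => by simpa [LinearMap.flip_apply, mulBilin_apply] using hW b
  have hδ : ∀ b, finrank k (K₀.map ((mulBilin k 2 n (m b)).flip (M b))) ≤
      finrank k (LinearMap.range ((mulBilin k 2 2 (m b)).flip) ⊓ Submodule.span k
        {L : Matrix (Fin 2) (Fin 2) k →ₗ[k] Matrix (Fin 2) (Fin (m b)) k |
          ∃ s ∈ O, ∃ B : Matrix (Fin 2) (Fin (m b)) k,
            (∀ X : Matrix (Fin 2) (Fin 2) k, X * B - (β.f s X * (β.f s 1)⁻¹) • B ∈ S b) ∧ L = (β.f s).smulRight B} :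
        Submodule k (Matrix (Fin 2) (Fin 2) k →ₗ[k] Matrix (Fin 2) (Fin (m b)) k)) :=
    fun b => finrank_block_map_ker_le β O hO hO' hcard (M b) (S b) (hS b)
  have := Finset.sum_le_sum fun b (_ : b ∈ Finset.univ) => hδ b
  omega

end Summit.MatrixMultiplication.OmegaCensus.SmallFormats
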